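import Summits.PneNP.PneNP.Theses.KrwChromaticSteering
import Summits.PneNP.PneNP.Theorems.KrwChromaticSteeringCompositionIterationIterate
import HarnessLib

/-!
# Crux `StrongComposition` (stmt-PneNP-18538): load-bearing hypotheses and refuted strengthenings

Negative lemmas of the refuter seat (pnp-krw-ref-1, 2026-08-27) for crux C1 of route
`KrwChromaticSteering`.  C1 asks, for every non-constant outer `f : {0,1}^m → {0,1}`, for SOME inner
`g : {0,1}ⁿ → {0,1}` such that every protocol for Meir's strong composition game `KW_f ⊛ KW_g`
yields a `KW_f` protocol shorter by `n − O(log (m n))`.  Together with C2 (`StandardFromStrong`) it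
is equivalent to the weak KRW conjecture in depth form (the hypothesis of `CompositionIteration`;
`Cruxes/StrongComposition/Disproof.lean`, `weakKRW_iff_cruxes`), so no refutation short of
`¬ weak KRW` exists; what CAN be certified is which hypotheses carry weight and which natural
strengthenings are false:

* `strongComposition_false_without_nonconst` — non-constancy of `f` is load-bearing: for constant
  `f` the strong game is vacuous and the depth-`0` leaf protocol beats `n − c·(⌊log₂ (m n)⌋ + 1)`;
* `not_strongComposition_forall_g` — the `∃ g` cannot be upgraded to `∀` non-constant `g`: for the
  dictator `g` (and `m = 1`, `f` the dictator) the depth-`0` protocol solves the strong game;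
* `strongComposition_constLoss_false_of_depthBound` — the `O(log (m n))` loss cannot be `O(1)`
  GIVEN the printed uniform depth bound `D(g) ≤ n − log₂ log₂ n + O(1)` (Gaskov 1978 / Lozhkin 1983,
  taken as a hypothesis — not in the tree): at `m = 1` the strong game IS `KW_g` on row `0`.

(`1 ≤ n` is NOT load-bearing — at `n = 0` the protocol type is empty — recorded in the Disproof work
file only, since that statement mentions C1 positively.)
-/

set_option linter.dupNamespace false
set_option autoImplicit false

open Literature.Computability.Complexity
open Summit.PneNP.PneNP.Theorems.KrwCompositionIteration (exists_mul_succ_lt_two_pow)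

namespace Summit.PneNP.PneNP.Theorems.StrongComposition.Negative

/-! ### Non-constancy of `f` is load-bearing -/

/-- **`StrongComposition` is false without the non-constancy hypothesis on `f`.**  Witness: `m = 1`,
`f ≡ true`, `n = 2^t` with `c·(t+1) < 2^t`; the strong game of a constant `f` is vacuous, the leaf
protocol (depth `0`) solves it, and the conclusion would force `2^t ≤ c·(t+1)`. [folklore] -/
theorem strongComposition_false_without_nonconst :
    ¬ ∃ c : ℕ, ∀ m n : ℕ, 1 ≤ n → ∀ f : (Fin m → Bool) → Bool,
      ∃ g : (Fin n → Bool) → Bool, ∀ P : KWTree (Fin m × Fin n), P.SolvesStrong f g →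
        ∃ Q : KWTree (Fin m), Q.Solves f ∧ Q.depth + n ≤ P.depth + c * (Nat.log 2 (m * n) + 1) := by
  rintro ⟨c, h⟩
  obtain ⟨t, ht⟩ := exists_mul_succ_lt_two_pow c
  have hn : 1 ≤ 2 ^ t := Nat.one_le_two_pow
  obtain ⟨g, hg⟩ := h 1 (2 ^ t) hn (fun _ => true)
  obtain ⟨Q, -, hQ⟩ := hg (KWTree.leaf ((0 : Fin 1), (⟨0, hn⟩ : Fin (2 ^ t))))
    (by intro X Y _ hY; simp at hY)
  rw [KWTree.depth_leaf, one_mul, Nat.log_pow one_lt_two] at hQ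
  omega

/-! ### The `∀ g` strengthening is false -/

/-- **`∃ g` cannot become `∀ g`.**  The strengthening of `StrongComposition` asserting the conclusion
for EVERY non-constant inner `g` is false.  Witness: `m = 1`, `f a = a 0`, `g u = u 0` (dictators),
`n = 2^t` with `c·(t+1) < 2^t`, and the depth-`0` protocol `leaf (0, 0)`: on `X ∈ (f ⋄ g)⁻¹(1)`,
`Y ∈ (f ⋄ g)⁻¹(0)` the entry `(0, 0)` differs and so do the row labels, so it solves `KW_f ⊛ KW_g`,
while the conclusion demands `2^t ≤ c·(t+1)`.  (Any proof of C1 must choose a depth-hard `g`.)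
[folklore] -/
theorem not_strongComposition_forall_g :
    ¬ ∃ c : ℕ, ∀ m n : ℕ, 1 ≤ n → ∀ f : (Fin m → Bool) → Bool, (∃ a b, f a ≠ f b) →
      ∀ g : (Fin n → Bool) → Bool, (∃ u v, g u ≠ g v) →
        ∀ P : KWTree (Fin m × Fin n), P.SolvesStrong f g →
          ∃ Q : KWTree (Fin m), Q.Solves f ∧ Q.depth + n ≤ P.depth + c * (Nat.log 2 (m * n) + 1) := by
  rintro ⟨c, h⟩
  obtain ⟨t, ht⟩ := exists_mul_succ_lt_two_pow c
  have hn : 1 ≤ 2 ^ t := Nat.one_le_two_pow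
  let j0 : Fin (2 ^ t) := ⟨0, hn⟩
  obtain ⟨Q, -, hQ⟩ := h 1 (2 ^ t) hn (fun a => a 0) ⟨fun _ => true, fun _ => false, by simp⟩
    (fun u => u j0) ⟨fun _ => true, fun _ => false, by simp⟩ (KWTree.leaf ((0 : Fin 1), j0))
    (by
      intro X Y hX hY
      simp only [blockComp_apply, rowLabels_apply, row_apply] at hX hY
      simp only [KWTree.run_leaf, rowLabels_apply, row_apply, hX, hY, ne_eq, Bool.true_eq_false,
        not_false_eq_true, and_self])
  rw [KWTree.depth_leaf, one_mul, Nat.log_pow one_lt_two] at hQ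
  omega

/-! ### The `O(1)`-loss strengthening is false modulo the Gaskov–Lozhkin depth bound -/

/-- **The loss cannot be `O(1)`, given `D(g) ≤ n − log₂ log₂ n + O(1)`.**  Hypothesis `hGL`: the
printed uniform depth upper bound for all `g : {0,1}ⁿ → {0,1}` (Gaskov 1978; Lozhkin 1983), stated
for KW protocols; it is not yet a tree theorem, hence a hypothesis here.  Under it, the variant of
`StrongComposition` with `c·(⌊log₂ (m n)⌋ + 1)` replaced by a constant `c` is false: at `m = 1`,
`f a = a 0`, the strong game `KW_f ⊛ KW_g` is solved by a `KW_g` protocol run on row `0`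
(`KWTree.onRow`), of depth `≤ n − log₂ log₂ n + c'`, and the conclusion would give
`log₂ log₂ n ≤ c + c'`, false at `n = 2^(2^(c+c'+1))`.  So the `O(log (m n))` slack of C1 is used at
least to order `log log n`. [cite: JuknaBFC2012, §1.4 (Lupanov-type upper bounds); folklore] -/
theorem strongComposition_constLoss_false_of_depthBound
    (hGL : ∃ c' : ℕ, ∀ n : ℕ, 1 ≤ n → ∀ g : (Fin n → Bool) → Bool,
      ∃ R : KWTree (Fin n), R.Solves g ∧ R.depth + Nat.log 2 (Nat.log 2 n) ≤ n + c') :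
    ¬ ∃ c : ℕ, ∀ m n : ℕ, 1 ≤ n → ∀ f : (Fin m → Bool) → Bool, (∃ a b, f a ≠ f b) →
      ∃ g : (Fin n → Bool) → Bool, ∀ P : KWTree (Fin m × Fin n), P.SolvesStrong f g →
        ∃ Q : KWTree (Fin m), Q.Solves f ∧ Q.depth + n ≤ P.depth + c := by
  rintro ⟨c, h⟩
  obtain ⟨c', hGL⟩ := hGL
  have hn : 1 ≤ 2 ^ (2 ^ (c + c' + 1)) := Nat.one_le_two_pow
  obtain ⟨g, hg⟩ := h 1 (2 ^ (2 ^ (c + c' + 1))) hn (fun a => a 0)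
    ⟨fun _ => true, fun _ => false, by simp⟩
  obtain ⟨R, hR, hRd⟩ := hGL _ hn g
  obtain ⟨Q, -, hQ⟩ := hg (KWTree.onRow 0 R) (by
    intro X Y hX hY
    simp only [blockComp_apply, rowLabels_apply] at hX hY
    refine ⟨?_, ?_⟩
    · simpa using hR (row X 0) (row Y 0) hX hY
    · simp [hX, hY])
  rw [KWTree.depth_onRow] at hQ
  rw [Nat.log_pow one_lt_two, Nat.log_pow one_lt_two] at hRd
  omega

end Summit.PneNP.PneNP.Theorems.StrongComposition.Negative
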